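import Summits.QuantumFields.YangMills.Theorems.LuscherReductionDressedRitzPolyakovLiftPScalingPrep
import Summits.QuantumFields.YangMills.Theorems.LuscherReductionDressedRitzVacuumDictionary
import HarnessLib

/-!
# Route `LuscherReduction`, item `DressedRitz` (stmt-QuantumFields-20205), line «polyakovlift» r6, stub S-PSCAL″ — THE SHADOW VECTOR `v = ins_{e₀}(f)`:
# reduction to the top eigenvector, spectral coefficients, norm and vacuum mean in terms of quasimode data (F9-III; LEAD prover ym-lead-20205-polyakovlift g2)

Setting (any lattice size, `β`): `e0` a normalised physical top eigenfunction (`K e0 = λ₀ e0`); `Φ₀` a physical vacuum quasimode with `a := ⟨Φ₀,e0⟩ ≠ 0`,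
`η := Φ₀ − a·e0` (so `e0 = a⁻¹(Φ₀ − η)`); `f` a physical bounded multiplier (`|f| ≤ C_f`), `Ψ` physical with `f·Φ₀ = Ψ` a.e. (tree
`shadowObs_mul_ground_ae` for transplanted observables); `v := ins_{e0}(f) = f·e0 − ⟨e0, f·e0⟩·e0`.

* `ins_smul_vac` — for a raw vacuum `e₀ = σ·e0`, `σ² = 1`: `ins_{e₀} f = σ • ins_{e0} f` (so every quadratic shadow datum may be computed at `e0`;
  with tree `PScal.rawVacuum_eq_smul` this is WLOG);
* `l2_ins_top` — `⟨v, e0⟩ = 0`;  `coeff_identity` — `a·⟨v, e′⟩ = ⟨Ψ, e′⟩ − ⟨f·η, e′⟩` for physical `e′ ⊥ e0`;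
* `a_mul_fe0_ae` — `a·(f·e0) = Ψ − f·η` a.e.;  `normSq_ins_le` — `‖v‖² ≤ ‖f·e0‖²`;  `a_sq_mul_normSq_fe0` — `a²‖f·e0‖² = ‖Ψ − f·η‖²`;
  `normSq_mul_le` — `‖f·η‖² ≤ C_f²‖η‖²`;  `a_sq_mul_mean` — `a²·⟨e0, f·e0⟩ = ⟨Φ₀ − η, Ψ − f·η⟩`.

HONEST FRAMING: fixed-lattice bookkeeping (conditional femto rung R2b1); nothing here bears on infinite volume, the continuum limit or the Clay gap.
References: Reed–Simon IV, Thm. XIII.1 [cite: ReedSimonIV1978, Thm. XIII.1]; M. Lüscher, U. Wolff, NPB 339 (1990) 222 [cite: LuscherWolff1990].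
-/

set_option autoImplicit false

noncomputable section

open MeasureTheory Filter Topology Real
open Literature.MathematicalPhysics.QuantumFieldTheory (GaugeConfig Site gaugeTransform)
open scoped BigOperators

namespace Summit.QuantumFields.YangMills.Theorems.FemtoTransferGap.PScal

open Summit.QuantumFields.YangMills.Theorems.FemtoTransferGap
open Summit.QuantumFields.YangMills.Theorems.FemtoTransferGap.VacDict (l2_mul_self_le abs_l2_le_sqrt_mul_sqrt)

variable {L : ℕ} [NeZero L]

/-! ## §1 Small dictionary -/

/-- `l2` only sees the a.e.-class of its left argument. [folklore] -/
theorem l2_congr_ae_left {f g h : GaugeConfig 3 L SU2 → ℝ} (hfg : f =ᵐ[configMeasure SU2 L] g) : l2 f h = l2 g h := by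
  unfold l2
  refine integral_congr_ae ?_
  filter_upwards [hfg] with U hU
  rw [hU]

/-- `l2` only sees the a.e.-class of its right argument. [folklore] -/
theorem l2_congr_ae_right {f g h : GaugeConfig 3 L SU2 → ℝ} (hfg : f =ᵐ[configMeasure SU2 L] g) : l2 h f = l2 h g := by
  rw [l2_comm, l2_congr_ae_left hfg, l2_comm]

/-- `qform` only sees a.e.-classes. [folklore] -/
theorem qform_congr_ae {β : ℝ} {f g f' g' : GaugeConfig 3 L SU2 → ℝ} (h1 : f =ᵐ[configMeasure SU2 L] f') (h2 : g =ᵐ[configMeasure SU2 L] g') :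
    qform su2Rep β f g = qform su2Rep β f' g' := by
  rw [qform_eq_l2_transferApply, qform_eq_l2_transferApply, PhysL2.transferApply_congr_ae h2, l2_congr_ae_left h1]

/-- `‖f·η‖² ≤ C_f²‖η‖²` for a bounded physical multiplier. [folklore] -/
theorem normSq_mul_le {f η : GaugeConfig 3 L SU2 → ℝ} (hf : IsPhys f) (hη : IsPhys η) {Cf : ℝ} (hCf : ∀ U, |f U| ≤ Cf) :
    l2 (f * η) (f * η) ≤ Cf ^ 2 * l2 η η :=
  l2_mul_self_le hf hη hCf

/-! ## §2 Raw vacuum versus top eigenvector -/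

/-- ★ For a raw vacuum `e₀ = σ·e0` with `σ² = 1`: `ins_{e₀} f = σ • ins_{e0} f`. [cite: LuscherWolff1990] -/
theorem ins_smul_vac {e₀ e0 : GaugeConfig 3 L SU2 → ℝ} {σ : ℝ} (hσ : e₀ = σ • e0) (hσ2 : σ ^ 2 = 1) (f : GaugeConfig 3 L SU2 → ℝ) :
    OpPlat.ins e₀ f = σ • OpPlat.ins e0 f := by
  have hff : f * (σ • e0) = σ • (f * e0) := by funext U; simp [Pi.smul_apply, smul_eq_mul]; ring
  rw [OpPlat.ins_eq, OpPlat.ins_eq, hσ, hff, OpPlat.l2_smul_smul, ← sq, hσ2, one_mul, smul_sub]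
  congr 1
  rw [smul_smul, smul_smul, mul_comm]

/-- Quadratic data are blind to `σ = ±1`: `⟨σ•x, σ•y⟩ = ⟨x, y⟩`. [folklore] -/
theorem l2_smul_smul_of_sq_eq_one {σ : ℝ} (hσ2 : σ ^ 2 = 1) (x y : GaugeConfig 3 L SU2 → ℝ) : l2 (σ • x) (σ • y) = l2 x y := by
  rw [OpPlat.l2_smul_smul, ← sq, hσ2, one_mul]

/-- `K^[m](σ • x) = σ • K^[m] x`. [folklore] -/
theorem iterate_transferApply_smul (β σ : ℝ) (m : ℕ) (x : GaugeConfig 3 L SU2 → ℝ) :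
    (transferApply β)^[m] (σ • x) = σ • (transferApply β)^[m] x := by
  induction m generalizing x with
  | zero => rfl
  | succ m ih => rw [Function.iterate_succ_apply, Function.iterate_succ_apply, transferApply_smul, ih]

/-! ## §3 The shadow vector at the top eigenvector -/

section Shadow

variable {β : ℝ} {e0 Φ₀ Ψ f : GaugeConfig 3 L SU2 → ℝ}

/-- ★ `⟨ins_{e0} f, e0⟩ = 0`. [cite: LuscherWolff1990] -/
theorem l2_ins_top (he0 : IsPhys e0) (hn0 : l2 e0 e0 = 1) (hf : IsPhys f) : l2 (OpPlat.ins e0 f) e0 = 0 := by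
  have hfe : IsPhys (f * e0) := OpPlat.isPhys_mul hf he0
  have h := map_sub (l2Form L) (⟨f * e0, hfe⟩ : physSubmodule L) (l2 e0 (f * e0) • ⟨e0, he0⟩)
  have h' := congrArg (fun φ : physSubmodule L →ₗ[ℝ] ℝ => φ ⟨e0, he0⟩) h
  simp only [map_smul, LinearMap.sub_apply, LinearMap.smul_apply, l2Form_apply, Submodule.coe_sub, Submodule.coe_smul, smul_eq_mul] at h'
  rw [OpPlat.ins_eq]
  rw [h', hn0, mul_one, l2_comm, sub_self]

/-- ★ `a·(f·e0) = Ψ − f·η` almost everywhere (`η = Φ₀ − a·e0`), from `f·Φ₀ = Ψ` a.e. [folklore] -/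
theorem a_mul_fe0_ae (hprod : f * Φ₀ =ᵐ[configMeasure SU2 L] Ψ) (a : ℝ) :
    a • (f * e0) =ᵐ[configMeasure SU2 L] Ψ - f * (Φ₀ - a • e0) := by
  filter_upwards [hprod] with U hU
  have : (a • (f * e0)) U = (f * Φ₀) U - (f * (Φ₀ - a • e0)) U := by
    simp only [Pi.smul_apply, Pi.mul_apply, Pi.sub_apply, smul_eq_mul]; ring
  rw [this, hU]; rfl

/-- ★ **Coefficient identity**: for physical `e′ ⊥ e0`, `a·⟨ins_{e0} f, e′⟩ = ⟨Ψ, e′⟩ − ⟨f·(Φ₀ − a e0), e′⟩`. [cite: ReedSimonIV1978, Thm. XIII.1] -/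
theorem coeff_identity (he0 : IsPhys e0) (hΦ₀ : IsPhys Φ₀) (hΨ : IsPhys Ψ) (hf : IsPhys f) (hprod : f * Φ₀ =ᵐ[configMeasure SU2 L] Ψ)
    (a : ℝ) {e' : GaugeConfig 3 L SU2 → ℝ} (he' : IsPhys e') (horth : l2 e0 e' = 0) :
    a * l2 (OpPlat.ins e0 f) e' = l2 Ψ e' - l2 (f * (Φ₀ - a • e0)) e' := by
  have hfe : IsPhys (f * e0) := OpPlat.isPhys_mul hf he0
  have hη : IsPhys (Φ₀ - a • e0) := ((⟨Φ₀, hΦ₀⟩ : physSubmodule L) - a • (⟨e0, he0⟩ : physSubmodule L)).2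
  have hfη : IsPhys (f * (Φ₀ - a • e0)) := OpPlat.isPhys_mul hf hη
  have h1 : l2 (OpPlat.ins e0 f) e' = l2 (f * e0) e' := by
    have h := map_sub (l2Form L) (⟨f * e0, hfe⟩ : physSubmodule L) (l2 e0 (f * e0) • ⟨e0, he0⟩)
    have h' := congrArg (fun φ : physSubmodule L →ₗ[ℝ] ℝ => φ ⟨e', he'⟩) h
    simp only [map_smul, LinearMap.sub_apply, LinearMap.smul_apply, l2Form_apply, Submodule.coe_sub, Submodule.coe_smul, smul_eq_mul] at h'
    rw [OpPlat.ins_eq, h', horth, mul_zero, sub_zero]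
  have h2 : a * l2 (f * e0) e' = l2 (Ψ - f * (Φ₀ - a • e0)) e' := by
    rw [← l2_smul_left, l2_congr_ae_left (a_mul_fe0_ae hprod a)]
  have h3 : l2 (Ψ - f * (Φ₀ - a • e0)) e' = l2 Ψ e' - l2 (f * (Φ₀ - a • e0)) e' := by
    have h := map_sub (l2Form L) (⟨Ψ, hΨ⟩ : physSubmodule L) ⟨f * (Φ₀ - a • e0), hfη⟩
    have h' := congrArg (fun φ : physSubmodule L →ₗ[ℝ] ℝ => φ ⟨e', he'⟩) h
    simpa only [LinearMap.sub_apply, l2Form_apply, Submodule.coe_sub] using h'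
  rw [h1, h2, h3]

/-- `‖ins_{e0} f‖² = ‖f·e0‖² − ⟨e0, f·e0⟩²` (Pythagoras against the unit vector `e0`). [folklore] -/
theorem normSq_ins_eq (he0 : IsPhys e0) (hn0 : l2 e0 e0 = 1) (hf : IsPhys f) :
    l2 (OpPlat.ins e0 f) (OpPlat.ins e0 f) = l2 (f * e0) (f * e0) - l2 e0 (f * e0) ^ 2 := by
  have hfe : IsPhys (f * e0) := OpPlat.isPhys_mul hf he0
  set c := l2 e0 (f * e0) with hc
  have hins : OpPlat.ins e0 f = ((⟨f * e0, hfe⟩ : physSubmodule L) - c • (⟨e0, he0⟩ : physSubmodule L) : physSubmodule L) := by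
    rw [OpPlat.ins_eq]; rfl
  have h : l2Form L ((⟨f * e0, hfe⟩ : physSubmodule L) - c • ⟨e0, he0⟩) ((⟨f * e0, hfe⟩ : physSubmodule L) - c • ⟨e0, he0⟩) =
      l2 (f * e0) (f * e0) - c ^ 2 := by
    simp only [map_sub, map_smul, LinearMap.sub_apply, LinearMap.smul_apply, l2Form_apply, smul_eq_mul, hn0]
    rw [l2_comm (f * e0) e0, ← hc]; ring
  rw [hins]; exact h

/-- ★ `‖ins_{e0} f‖² ≤ ‖f·e0‖²`. [folklore] -/
theorem normSq_ins_le (he0 : IsPhys e0) (hn0 : l2 e0 e0 = 1) (hf : IsPhys f) :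
    l2 (OpPlat.ins e0 f) (OpPlat.ins e0 f) ≤ l2 (f * e0) (f * e0) := by
  rw [normSq_ins_eq he0 hn0 hf]; nlinarith [sq_nonneg (l2 e0 (f * e0))]

/-- ★ `a²‖f·e0‖² = ‖Ψ − f·η‖²`. [folklore] -/
theorem a_sq_mul_normSq_fe0 (hprod : f * Φ₀ =ᵐ[configMeasure SU2 L] Ψ) (a : ℝ) :
    a ^ 2 * l2 (f * e0) (f * e0) = l2 (Ψ - f * (Φ₀ - a • e0)) (Ψ - f * (Φ₀ - a • e0)) := by
  have hae := a_mul_fe0_ae (e0 := e0) hprod a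
  rw [← l2_congr_ae_left hae, ← l2_congr_ae_right hae, OpPlat.l2_smul_smul, sq]

/-- ★ `a²·⟨e0, f·e0⟩ = ⟨Φ₀ − η, Ψ − f·η⟩` (the vacuum mean of the observable in quasimode data). [folklore] -/
theorem a_sq_mul_mean (hprod : f * Φ₀ =ᵐ[configMeasure SU2 L] Ψ) (a : ℝ) :
    a ^ 2 * l2 e0 (f * e0) = l2 (Φ₀ - (Φ₀ - a • e0)) (Ψ - f * (Φ₀ - a • e0)) := by
  have hae := a_mul_fe0_ae (e0 := e0) hprod a
  have h1 : Φ₀ - (Φ₀ - a • e0) = a • e0 := by abel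
  rw [h1, ← l2_congr_ae_right hae, OpPlat.l2_smul_smul, sq]

/-- `‖Ψ − f·η‖² ≤ (‖Ψ‖ + C_f‖η‖)²` (`C_f ≥ 0`). [folklore] -/
theorem normSq_sub_mul_le (he0 : IsPhys e0) (hΦ₀ : IsPhys Φ₀) (hΨ : IsPhys Ψ) (hf : IsPhys f) {Cf : ℝ} (hCf : ∀ U, |f U| ≤ Cf)
    (hCf0 : 0 ≤ Cf) (a : ℝ) :
    l2 (Ψ - f * (Φ₀ - a • e0)) (Ψ - f * (Φ₀ - a • e0)) ≤
      (Real.sqrt (l2 Ψ Ψ) + Cf * Real.sqrt (l2 (Φ₀ - a • e0) (Φ₀ - a • e0))) ^ 2 := by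
  have hη : IsPhys (Φ₀ - a • e0) := ((⟨Φ₀, hΦ₀⟩ : physSubmodule L) - a • (⟨e0, he0⟩ : physSubmodule L)).2
  have hfη : IsPhys (f * (Φ₀ - a • e0)) := OpPlat.isPhys_mul hf hη
  set y := f * (Φ₀ - a • e0) with hy
  have hexp : l2 (Ψ - y) (Ψ - y) = l2 Ψ Ψ - 2 * l2 Ψ y + l2 y y := by
    have h : l2Form L ((⟨Ψ, hΨ⟩ : physSubmodule L) - ⟨y, hfη⟩) ((⟨Ψ, hΨ⟩ : physSubmodule L) - ⟨y, hfη⟩) = l2 Ψ Ψ - 2 * l2 Ψ y + l2 y y := by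
      simp only [map_sub, LinearMap.sub_apply, l2Form_apply]
      rw [l2_comm y Ψ]; ring
    exact h
  have hcs := abs_l2_le_sqrt_mul_sqrt hΨ hfη
  have hyy : l2 y y ≤ Cf ^ 2 * l2 (Φ₀ - a • e0) (Φ₀ - a • e0) := normSq_mul_le hf hη hCf
  have hy0 : 0 ≤ l2 y y := l2_self_nonneg _
  have hΨ0 : 0 ≤ l2 Ψ Ψ := l2_self_nonneg _
  have hη0 : 0 ≤ l2 (Φ₀ - a • e0) (Φ₀ - a • e0) := l2_self_nonneg _
  have hsy : Real.sqrt (l2 y y) ≤ Cf * Real.sqrt (l2 (Φ₀ - a • e0) (Φ₀ - a • e0)) := by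
    rw [← Real.sqrt_sq hCf0, ← Real.sqrt_mul (sq_nonneg Cf)]
    exact Real.sqrt_le_sqrt hyy
  rw [hexp]
  have h1 : -(2 * l2 Ψ y) ≤ 2 * (Real.sqrt (l2 Ψ Ψ) * Real.sqrt (l2 y y)) := by linarith [(abs_le.1 hcs).1]
  nlinarith [Real.sq_sqrt hΨ0, Real.sq_sqrt hy0, Real.sq_sqrt hη0, Real.sqrt_nonneg (l2 Ψ Ψ), Real.sqrt_nonneg (l2 y y),
    Real.sqrt_nonneg (l2 (Φ₀ - a • e0) (Φ₀ - a • e0)), hsy, h1]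

end Shadow

end Summit.QuantumFields.YangMills.Theorems.FemtoTransferGap.PScal

end
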